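import Mathlib
import HarnessLib.Audit
import Summits.PneNP.PneNP.Theorems.PstarNorUnitDirection
import Summits.PneNP.PneNP.Theorems.PstarUnionCaseAEQ1
import Summits.PneNP.PneNP.Theorems.PstarUnionCaseBSheet

/-!
# Case B with two chords, one system: the direction picture in the READ direction `(0,1)` (ROUND-24, memo §14.24; toward `CaseBFive`)

FRONTIER range-avoidance ladder, rung F-N3, ROUND 24 (cell `pnp-ideate`, planner memo `r24/CORE-BOUND-NOTES.md` §14.21–§14.24 (planner p3 g22: "CASE B ↔ DIRECTION PICTURE DICTIONARY");
restricted-model proof complexity — nothing here bears on `P` versus `NP`).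

Bridge data `B` for ONE pair `(R, w₂)` in the normal form of Case B: `R = (C₁, G₁, b₁)` chord-BLIND and gate-free, `w₂ = (C₂, G₂, b₂)` gate-free and READING a literal of every chord,
(T3), lift.  All private reads lie on the line of `m = (0,1)`, and `q_m = free₁ + b₁` is the reader's own form.  The reversed containment (`PstarUnionCaseBSheet.free₁_on_sheet`:
the sheet `{u_c = 0}` lies in `{free₁ = b₁ + 1}`) reads, contraposed, as the (★★) containment `Z(q_m) ⊆ {u_c = 1}` for EVERY chord — from (T3) alone, no minimality.  Hence
the terminal-core direction picture runs verbatim in direction `(0,1)`: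

* `card_le_five_caseB_dir` — if `q_m` has a zero (the reader is not constant on the cube) and there are at least TWO chords, then `#J₀ ≤ 5`: per chord (EQ) / EXC-unit / (NOR)
  by `PstarForcing.forcing_cases` + `PstarNorUnitExcCore.exc_unit_core`; branches (a) NOR and (b) unit are the tree's structural counts; branch (c) "every chord (EQ)" forces a
  SINGLE chord (`chord_eq_of_EQ`), excluded by hypothesis.  (The single-chord world and the assembly from `UnionTerminal` via B-I/B-II alignment are separate.)
-/

set_option linter.dupNamespace false -- `Summit.PneNP.PneNP.…`: summit = sub-problem name (D-0017 single-conjunct layout)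

open Finset Module Literature.Computability.Complexity
open scoped symmDiff
open Summit.PneNP.PneNP.Theorems.PstarFibrePolys (bit bit_injective)
open Summit.PneNP.PneNP.Theorems.PstarTyped (Typed)
open Summit.PneNP.PneNP.Theorems.PstarSALevel (varSet bdry BoundaryExpanding SimpleOverlap)
open Summit.PneNP.PneNP.Theorems.PstarCoreBound (XorClosed)
open Summit.PneNP.PneNP.Theorems.PstarGapLinearised (andPair)
open Summit.PneNP.PneNP.Theorems.PstarGapOneAll (gval)
open Summit.PneNP.PneNP.Theorems.PstarXCore (xverts)
open Summit.PneNP.PneNP.Theorems.PstarCubeIdeals (IsAffineFn)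
open Summit.PneNP.PneNP.Theorems.PstarProductRank (qform polar)
open Summit.PneNP.PneNP.Theorems.PstarPathRank (AndAdj)
open Summit.PneNP.PneNP.Theorems.PstarForcing (forcing_cases)
open Summit.PneNP.PneNP.Theorems.PstarChordRepair (IsChord)
open Summit.PneNP.PneNP.Theorems.PstarChordBridgeTools (xpdeg privs vars_mem_privs uval free coef bit_gval_eq)
open Summit.PneNP.PneNP.Theorems.PstarChordBridge (BridgeData sys Solution Lift sys_u)
open Summit.PneNP.PneNP.Theorems.PstarReadSumset (V2)
open Summit.PneNP.PneNP.Theorems.PstarChordBridgeFundamental (eq_of_fundamental_eq two_le_card_of_even)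
open Summit.PneNP.PneNP.Theorems.PstarChordBridgeForcing (gam sys_u_eq qform_add' rank_four_of_wf chord_eq_of_EQ coef_of_unread)
open Summit.PneNP.PneNP.Theorems.PstarChordBridgeCotree (Peelable)
open Summit.PneNP.PneNP.Theorems.PstarChordBridgeBasis (qDir polarDir)
open Summit.PneNP.PneNP.Theorems.PstarChordBridgeCorner (qDir_add)
open Summit.PneNP.PneNP.Theorems.PstarNorUnitExcCore (exc_unit_core)
open Summit.PneNP.PneNP.Theorems.PstarNorUnitMixed (false_of_nor_of_excUnit D_eq_of_excUnits card_units_le_five_of_EQ_of_excUnit)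
open Summit.PneNP.PneNP.Theorems.PstarNorUnitDirAssembly (xorClosed_units not_EQ_of_nor_dir)
open Summit.PneNP.PneNP.Theorems.PstarNorUnitCoverTools (two_le_xpdeg_of_xorClosed)
open Summit.PneNP.PneNP.Theorems.PstarNorUnitCover (subset_units)
open Summit.PneNP.PneNP.Theorems.PstarNorUnitFinal (card_le_five_of_regime_nor)
open Summit.PneNP.PneNP.Theorems.PstarNorUnitRegime (J₀_eq_of_single)
open Summit.PneNP.PneNP.Theorems.PstarUnionCaseAEQ1 (qDir_zero_one)
open Summit.PneNP.PneNP.Theorems.PstarUnionCaseBSheet (free₁_on_sheet)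

namespace Summit.PneNP.PneNP.Theorems.PstarUnionCaseBTwo

variable {n m : ℕ}

/-- **Case B, two chords, one system: `#J₀ ≤ 5`.**  See the module docstring. -/
theorem card_le_five_caseB_dir (I : LocalMap 4 n m) (hI : I.IsPure xorAndPred) (hT : Typed I) (hS : SimpleOverlap I) {r : ℕ}
    (hB : BoundaryExpanding r I) {B : BridgeData n m} (hW : B.WF I) (hJr : B.J₀.card < r) (hr : (B.J₀ ∪ B.G₁ ∪ B.G₂).card ≤ r)
    (hX : XorClosed I B.J₀) (hP : Peelable I (B.J₀ \ B.N)) (hG₁ : Disjoint B.G₁ B.J₀) (hG₂ : Disjoint B.G₂ B.J₀) (hN : 2 ≤ B.N.card)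
    (hL : Lift I B)
    (hun : ∀ v ∈ privs I B.N, (∀ g ∈ B.G₁, I.vars g 2 ≠ v ∧ I.vars g 3 ≠ v) ∧ ∀ g ∈ B.G₂, I.vars g 2 ≠ v ∧ I.vars g 3 ≠ v)
    (hblind₁ : ∀ v ∈ privs I B.N, v ∉ B.C₁) (hreads : ∀ c ∈ B.N, I.vars c 2 ∈ B.C₂ ∨ I.vars c 3 ∈ B.C₂)
    (hT3 : ¬ ∃ z, Solution I B B.J₀ z) (hZne : ∃ a, free I B.y (B.J₀ \ B.N) B.N B.T₁ B.C₁ B.G₁ a = bit B.b₁) :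
    B.J₀.card ≤ 5 := by
  classical
  set mv : V2 := ((0 : ZMod 2), (1 : ZMod 2)) with hmv
  -- (★★) in the read direction: the reversed containment, contraposed
  have hZc : ∀ e ∈ B.N, ∀ x, qDir I B mv x = 0 → qform (B.D e) (fun j => I.vars j 2) (fun j => I.vars j 3) x = gam B e + 1 := by
    intro e he x hx
    rw [hmv, qDir_zero_one] at hx
    have hu := sys_u_eq I B e x
    rw [sys_u] at hu
    rcases (by decide : ∀ t : ZMod 2, t = 0 ∨ t = 1) (uval I B.y (B.D e) e x) with h0 | h1
    · have h := free₁_on_sheet I hI hT hW hL hun hblind₁ hT3 he (hreads e he) h0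
      rw [h] at hx
      exact absurd hx (by generalize bit B.b₁ = b; revert b; decide)
    · rw [hu] at h1
      have e1 : ∀ g Q : ZMod 2, g + Q = 1 → Q = g + 1 := by decide
      exact e1 _ _ h1
  obtain ⟨a₀, ha₀⟩ := hZne
  have hq0 : qDir I B mv a₀ = 0 := by rw [hmv, qDir_zero_one, ha₀]; generalize bit B.b₁ = b; revert b; decide
  have heG : ∀ e ∈ B.N, e ∉ B.G₁ ∪ B.G₂ := fun e he h => by
    rcases mem_union.1 h with h | h
    · exact Finset.disjoint_left.1 hG₁ h (hW.hN he)
    · exact Finset.disjoint_left.1 hG₂ h (hW.hN he)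
  have hqB : ∀ x w, qDir I B mv (x + w) = qDir I B mv x + qDir I B mv w + qDir I B mv 0 + polarDir I B mv x w := qDir_add I B mv
  -- per chord: (EQ) / EXC-unit / (NOR)
  have hcls : ∀ e ∈ B.N,
      (∃ κ : ZMod 2, ∀ x, qform (B.D e) (fun j => I.vars j 2) (fun j => I.vars j 3) x = qDir I B mv x + κ) ∨
      (∃ j₁ j₂ : Fin m, ∃ σ τ : Fin n, j₁ ≠ j₂ ∧ B.D e = {j₁, j₂} ∧ Disjoint (andPair I j₁) (andPair I j₂) ∧
        σ ∈ andPair I j₁ ∧ τ ∈ andPair I j₂ ∧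
        ∀ v w : Fin n, polarDir I B mv (Pi.single v 1) (Pi.single w 1) =
          (if AndAdj I (B.D e) v w then 1 else 0) + (if (v = σ ∧ w = τ) ∨ (v = τ ∧ w = σ) then 1 else 0)) ∨
      (∃ a b : Fin n → ZMod 2, polarDir I B mv a b = 1 ∧
        (∀ x, qDir I B mv x =
          (polarDir I B mv x b + (qDir I B mv b + qDir I B mv 0)) * (polarDir I B mv x a + (qDir I B mv a + qDir I B mv 0)) + 1) ∧
        ∃ m₁ m₂ : (Fin n → ZMod 2) → ZMod 2, IsAffineFn m₁ ∧ IsAffineFn m₂ ∧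
          ∀ x, qform (B.D e) (fun j => I.vars j 2) (fun j => I.vars j 3) x + (gam B e + 1) =
            (polarDir I B mv x b + (qDir I B mv b + qDir I B mv 0) + 1) * m₁ x +
            (polarDir I B mv x a + (qDir I B mv a + qDir I B mv 0) + 1) * m₂ x) := by
    intro e he
    rcases forcing_cases hqB (qform_add' I (B.D e)) (rank_four_of_wf I hI hS hB hW hJr.le he) (hZc e he) with
        h1 | h | ⟨ν₁, ν₂, hν₁, hν₂, κ, h⟩ | h
    · exact absurd (h1 a₀) (by rw [hq0]; exact zero_ne_one)
    · exact Or.inl h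
    · rcases exc_unit_core I hI hS hB hW hr he (heG e he) mv hqB (hZc e he) hν₁ hν₂ h with h' | ⟨j₁, j₂, σ, τ, hne, hDe, hdisj, hσ, hτ, -, hform, -⟩
      · exact Or.inl h'
      · exact Or.inr (Or.inl ⟨j₁, j₂, σ, τ, hne, hDe, hdisj, hσ, hτ, hform⟩)
    · exact Or.inr (Or.inr h)
  -- (a) some (NOR) chord ⟹ every chord (NOR)
  by_cases hNOR : ∃ e ∈ B.N, ∃ a b : Fin n → ZMod 2, polarDir I B mv a b = 1 ∧
      (∀ x, qDir I B mv x =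
        (polarDir I B mv x b + (qDir I B mv b + qDir I B mv 0)) * (polarDir I B mv x a + (qDir I B mv a + qDir I B mv 0)) + 1) ∧
      ∃ m₁ m₂ : (Fin n → ZMod 2) → ZMod 2, IsAffineFn m₁ ∧ IsAffineFn m₂ ∧
        ∀ x, qform (B.D e) (fun j => I.vars j 2) (fun j => I.vars j 3) x + (gam B e + 1) =
          (polarDir I B mv x b + (qDir I B mv b + qDir I B mv 0) + 1) * m₁ x +
          (polarDir I B mv x a + (qDir I B mv a + qDir I B mv 0) + 1) * m₂ x
  · obtain ⟨e₁, he₁, a₁, b₁, -, hq₁, -⟩ := hNOR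
    refine card_le_five_of_regime_nor I hI hT hS hB hW hr hJr hX hP hG₁ hG₂ (card_pos.1 (by omega)) mv fun e he => ?_
    rcases hcls e he with ⟨κ, hκ⟩ | ⟨j₁, j₂, σ, τ, -, hDe, hdisj, hσ, hτ, hform⟩ | h
    · exact (not_EQ_of_nor_dir I hI hS hB hW hJr.le mv hq₁ he hκ).elim
    · exact (false_of_nor_of_excUnit I hI hDe hdisj hσ hτ hform hq₁).elim
    · exact h
  -- (b) no (NOR) chord, some EXC-unit `e`
  by_cases hUNIT : ∃ e ∈ B.N, ∃ j₁ j₂ : Fin m, ∃ σ τ : Fin n, j₁ ≠ j₂ ∧ B.D e = {j₁, j₂} ∧ Disjoint (andPair I j₁) (andPair I j₂) ∧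
      σ ∈ andPair I j₁ ∧ τ ∈ andPair I j₂ ∧
      ∀ v w : Fin n, polarDir I B mv (Pi.single v 1) (Pi.single w 1) =
        (if AndAdj I (B.D e) v w then 1 else 0) + (if (v = σ ∧ w = τ) ∨ (v = τ ∧ w = σ) then 1 else 0)
  · obtain ⟨e, he, j₁, j₂, σ, τ, hne, hDe, hdisj, hσ, hτ, hform⟩ := hUNIT
    have heD : e ∉ B.D e := fun h => (mem_sdiff.1 (hW.hD e he h)).2 he
    have hother : ∀ e' ∈ B.N, e' ≠ e →
        ∃ κ : ZMod 2, ∀ x, qform (B.D e') (fun j => I.vars j 2) (fun j => I.vars j 3) x = qDir I B mv x + κ := by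
      intro e' he' hne'
      rcases hcls e' he' with h | ⟨k₁, k₂, σ', τ', hne'', hDe', hdisj', hσ', hτ', hform'⟩ | h
      · exact h
      · exfalso
        have hDD : B.D e' = B.D e := D_eq_of_excUnits I hI hS hDe hdisj hσ hτ hform hne'' hDe' hdisj' hσ' hτ' hform'
        have he'D : e' ∉ B.D e := fun h => (mem_sdiff.1 (hW.hD e' he' (hDD ▸ h))).2 he'
        have heven' : ∀ w, Even (xpdeg I (insert e' (B.D e)) w) := fun w => by
          have h := hW.hDeven e' he' w
          rwa [hDD] at h
        exact hne' (eq_of_fundamental_eq I hI hS he'D heD heven' (hW.hDeven e he))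
      · exact absurd ⟨e', he', h⟩ hNOR
    by_cases hsingle : ∀ e' ∈ B.N, e' = e
    · have hNe : B.N = {e} := eq_singleton_iff_unique_mem.2 ⟨he, hsingle⟩
      have h3 : B.J₀.card = 3 := by
        rw [J₀_eq_of_single I hI hT hW hX hP hNe, card_insert_of_notMem heD, hDe, card_pair hne]
      omega
    · push Not at hsingle
      obtain ⟨e', he', hne'⟩ := hsingle
      obtain ⟨κ', hκ'⟩ := hother e' he' hne'
      have hNe : B.N = {e, e'} := by
        refine Subset.antisymm (fun f hf => ?_) fun f hf => ?_
        · rw [mem_insert, mem_singleton]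
          by_cases hfe : f = e
          · exact Or.inl hfe
          · obtain ⟨κf, hκf⟩ := hother f hf hfe
            exact Or.inr (chord_eq_of_EQ I hI hS hW hf he' hκf hκ')
        · rw [mem_insert, mem_singleton] at hf
          rcases hf with rfl | rfl
          · exact he
          · exact he'
      have h5 := card_units_le_five_of_EQ_of_excUnit I hI hS hDe hdisj hσ hτ hform hqB hκ' hNe
      exact le_trans (card_le_card (subset_units I hI hS hW.hN hP hW.hD hW.hDeven (two_le_xpdeg_of_xorClosed I hT hX)
        (two_le_xpdeg_of_xorClosed I hT (xorClosed_units I hI hW)) h5)) h5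
  -- (c) every chord (EQ): a single chord — excluded by `2 ≤ #N`
  have hEQ : ∀ e ∈ B.N, ∃ κ : ZMod 2, ∀ x, qform (B.D e) (fun j => I.vars j 2) (fun j => I.vars j 3) x = qDir I B mv x + κ := by
    intro e he
    rcases hcls e he with h | h | h
    · exact h
    · exact absurd ⟨e, he, h⟩ hUNIT
    · exact absurd ⟨e, he, h⟩ hNOR
  obtain ⟨e₁, he₁⟩ : B.N.Nonempty := card_pos.1 (by omega)
  obtain ⟨κ₁, hκ₁⟩ := hEQ e₁ he₁
  have hNe : B.N = {e₁} := by
    refine eq_singleton_iff_unique_mem.2 ⟨he₁, fun e he => ?_⟩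
    obtain ⟨κ, hκ⟩ := hEQ e he
    exact chord_eq_of_EQ I hI hS hW he he₁ hκ hκ₁
  rw [hNe, card_singleton] at hN
  omega

end Summit.PneNP.PneNP.Theorems.PstarUnionCaseBTwo
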